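import Summits.ResolutionOfSingularities.ResolutionOfSingularities.Theorems.FrobeniusLadderFInjectiveMacaulayficationFullLastCentreFibre
import HarnessLib

/-!
# K10n — THE ONE-STEP LAW HOLDS AT EVERY POINT OF THE EXCEPTIONAL FIBRE: `ρ″ ≤ 2ρ − ν_Z` after one blow-up of a coordinate centre, at the chart origin (K10) AND at every
# other point of the fibre over the base point (this file) — the NON-equi-ω companion of K10j's fibre no-rise law
# (crux `FInjectiveMacaulayfication` stmt-ResolutionOfSingularities-15315, chain w45a; register rows #13 (one-step law) / #16 LOW-ORDER LEDGER («the same question at origins and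
# fibre points»); seat res-L1-w45a-lead-1 g16)

[OURS · L1 W4.5a] Support file (`--supports stmt-ResolutionOfSingularities-15315 --as helper`); replaces the role of NO printed item; NOT a statement of any manuscript;
proves nothing of the crux; OURS counted 0. AI-written (AI review is weaker than expert review).

THE STATEMENT (★★ `ordLE_fibre_law`). Blow up `Z = V(x, y_Nor)` at a base point where the residual `N` of `Disc = y^α·N` has order `ρ` (`OrdLE N ρ`) and minimal normal
degree `ν = ν_Z(N)`; let `S′` be the `y_L`-chart origin and `S″` the stage at ANY point `y = c` of the fibre over the base point (`c` supported on the fibre letters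
`T = Nor ∖ {L}`). Then every residual decomposition at `S″` has `ρ″ ≤ 2ρ − ν` — the same law as at the chart origin (K10 `ordLE_iff`). MECHANISM (refining K10j): bigrade
`N′` by the SIGNATURE `(e_L, e|_{letters ∉ Nor})` of its monomials; the fibre translation `y_T ↦ y_T + c` preserves signatures monomial by monomial (`sig_translate_monomial`),
so it acts on each signature PIECE separately and cannot cancel across pieces (`piece_translate`); the piece through the transform of a minimal monomial `e₀` of `N`
(`tdeg e₀ ≤ ρ`) is non-zero and all its monomials have total degree `≤ ndeg e₀ + tdeg e₀ − ν ≤ 2ρ − ν` (`tdeg_le_of_piece`); translation preserves total degree (K10i) and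
the unit factor `U` of the transported residual does not raise orders. CONSEQUENCE: K10e/K10f-type propagation («`ρ′ ≤ 2ρ − ν`, high-order steps keep slacks non-positive»)
is valid at fibre points verbatim; the LOW-ORDER LEDGER question (K10l) is literally the same at origins and at fibre points. Exponent/coefficient bookkeeping only; no named fact.
-/

-- single-problem summit: the doubled namespace component is forced
set_option linter.dupNamespace false

noncomputable section

open MvPolynomial Finsupp
open Summit.ResolutionOfSingularities.ResolutionOfSingularities.Theorems.FInjectiveMacaulayfication.LastCentreDefs
open Summit.ResolutionOfSingularities.ResolutionOfSingularities.Theorems.FInjectiveMacaulayfication.LastCentreAxisOrder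
open Summit.ResolutionOfSingularities.ResolutionOfSingularities.Theorems.FInjectiveMacaulayfication.LastCentreSlack
open Summit.ResolutionOfSingularities.ResolutionOfSingularities.Theorems.FInjectiveMacaulayfication.LastCentreTame
open Summit.ResolutionOfSingularities.ResolutionOfSingularities.Theorems.FInjectiveMacaulayfication.LastCentreTranslate
open Summit.ResolutionOfSingularities.ResolutionOfSingularities.Theorems.FInjectiveMacaulayfication.LastCentreEquiChain
open Summit.ResolutionOfSingularities.ResolutionOfSingularities.Theorems.FInjectiveMacaulayfication.LastCentreFibre

namespace Summit.ResolutionOfSingularities.ResolutionOfSingularities.Theorems.FInjectiveMacaulayfication.LastCentreFibreLaw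

variable {k : Type} [Field k]

/-! ## 1. Signatures and pieces -/

/-- THE SIGNATURE of a monomial w.r.t. a set `K` of «kept» letters: its exponents on `K` (as a finitely supported function; the other exponents forgotten).
For the fibre law, `K = {L} ∪ (letters ∉ Nor)` — the letters a fibre translation does not move. [OURS · L1 W4.5a · definition] -/
def sig (K : Finset Letter) (e : Expo) : Expo := e.filter fun m => m ∈ K

/-- [plumbing] -/
theorem sig_apply (K : Finset Letter) (e : Expo) (m : Letter) : sig K e m = if m ∈ K then e m else 0 := by
  classical
  unfold sig; rw [Finsupp.filter_apply]

/-- [plumbing] -/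
theorem sig_add (K : Finset Letter) (a b : Expo) : sig K (a + b) = sig K a + sig K b := by
  classical
  ext m; rw [Finsupp.add_apply, sig_apply, sig_apply, sig_apply, Finsupp.add_apply]; split_ifs <;> simp

/-- A monomial supported OFF `K` has signature `0`. [plumbing] -/
theorem sig_eq_zero_of_support {K : Finset Letter} {f : Expo} (h : ∀ m ∈ K, f m = 0) : sig K f = 0 := by
  classical
  ext m; rw [sig_apply]; split_ifs with hm
  · exact h m hm
  · rfl

/-- THE PIECE of `G` of signature `σ`: the sum of its monomials of that signature. [OURS · L1 W4.5a · definition] -/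
def piece (K : Finset Letter) (σ : Expo) (G : YPoly k) : YPoly k :=
  ∑ e ∈ G.support with sig K e = σ, monomial e (coeff e G)

/-- COEFFICIENTS OF A PIECE. [plumbing] -/
theorem coeff_piece (K : Finset Letter) (σ : Expo) (G : YPoly k) (e : Expo) :
    coeff e (piece K σ G) = if sig K e = σ then coeff e G else 0 := by
  classical
  unfold piece
  rw [coeff_sum]
  simp only [coeff_monomial]
  split_ifs with hσ
  · by_cases he : e ∈ G.support
    · rw [Finset.sum_eq_single e (fun b hb hne => if_neg hne) (fun hn => ?_)]
      · rw [if_pos rfl]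
      · exact absurd (Finset.mem_filter.mpr ⟨he, hσ⟩) hn
    · rw [Finset.sum_eq_zero (fun b hb => ?_)]
      · exact (MvPolynomial.notMem_support_iff.mp he).symm
      · rw [Finset.mem_filter] at hb
        exact if_neg fun h : b = e => he (h ▸ hb.1)
  · exact Finset.sum_eq_zero fun b hb => by
      rw [Finset.mem_filter] at hb
      exact if_neg fun h : b = e => hσ (h ▸ hb.2)

/-- A monomial of a piece is a monomial of `G` of that signature. [plumbing] -/
theorem mem_support_of_piece {K : Finset Letter} {σ : Expo} {G : YPoly k} {e : Expo} (h : e ∈ (piece K σ G).support) :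
    e ∈ G.support ∧ sig K e = σ := by
  rw [MvPolynomial.mem_support_iff, coeff_piece] at h
  by_cases hs : sig K e = σ
  · rw [if_pos hs] at h; exact ⟨MvPolynomial.mem_support_iff.mpr h, hs⟩
  · rw [if_neg hs] at h; exact absurd rfl h

/-- The piece through a monomial of `G` is non-zero. [plumbing] -/
theorem piece_ne_zero {K : Finset Letter} {G : YPoly k} {e : Expo} (he : e ∈ G.support) : piece K (sig K e) G ≠ 0 :=
  MvPolynomial.ne_zero_iff.mpr ⟨e, by rw [coeff_piece, if_pos rfl]; exact MvPolynomial.mem_support_iff.mp he⟩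

/-- Pieces are additive. [plumbing] -/
theorem piece_add (K : Finset Letter) (σ : Expo) (A B : YPoly k) : piece K σ (A + B) = piece K σ A + piece K σ B := by
  ext e; rw [coeff_add, coeff_piece, coeff_piece, coeff_piece, coeff_add]; split_ifs <;> simp

/-- The piece of a polynomial all of whose monomials have signature `σ₀`. [plumbing] -/
theorem piece_of_forall_sig {K : Finset Letter} {σ₀ : Expo} {P : YPoly k} (h : ∀ e ∈ P.support, sig K e = σ₀) (σ : Expo) :
    piece K σ P = if σ₀ = σ then P else 0 := by
  ext e
  rw [coeff_piece]
  by_cases he : e ∈ P.support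
  · have hs := h e he
    split_ifs with h1 h2 h2
    · rfl
    · exact absurd (hs.symm.trans h1) h2
    · exact absurd (hs ▸ h2) h1
    · rw [coeff_zero]
  · have h0 : coeff e P = 0 := MvPolynomial.notMem_support_iff.mp he
    split_ifs <;> simp [h0]

/-! ## 2. Fibre translations preserve signatures -/

/-- ★ THE MONOMIALS OF A TRANSLATED MONOMIAL KEEP THEIR EXPONENTS ON THE UNMOVED LETTERS: if `c` vanishes on `K`, every monomial of `translate c (y^s)` has the
signature of `s`. [OURS · L1 W4.5a] -/
theorem sig_translate_monomial {K : Finset Letter} {c : Letter → k} (hc : ∀ m ∈ K, c m = 0) (s : Expo) (a : k) {e : Expo}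
    (he : e ∈ (translate c (monomial s a)).support) : sig K e = sig K s := by
  classical
  -- translate (y^s) = y^{s′} · U with s′ = s on {c = 0} and U involving only letters with c ≠ 0 (as in K10i)
  let s' : Expo := s.filter fun m => c m = 0
  let F : Finset Letter := s.support.filter fun m => c m ≠ 0
  let U : YPoly k := ∏ m ∈ F, (X m + C (c m)) ^ s m
  have hs'app : ∀ n, s' n = if c n = 0 then s n else 0 := fun n => Finsupp.filter_apply _ _ n
  have hmono : translate c (monomial s (1 : k)) = monomial s' 1 * U := by
    rw [translate_monomial, C_1, one_mul, ← Finset.prod_filter_mul_prod_filter_not s.support (fun m => c m = 0)]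
    congr 1
    · rw [← prod_X_pow_eq_monomial, Finsupp.support_filter]
      refine Finset.prod_congr rfl fun m hm => ?_
      rw [Finset.mem_filter] at hm
      rw [hm.2, C_0, add_zero, hs'app m, if_pos hm.2]
  let Tc : Finset Letter := Finset.univ.filter fun m => c m ≠ 0
  have hkeepU : keep Tc U = U := by
    rw [map_prod]
    refine Finset.prod_congr rfl fun m hm => ?_
    rw [Finset.mem_filter] at hm
    have hmT : m ∈ Tc := Finset.mem_filter.mpr ⟨Finset.mem_univ m, hm.2⟩
    rw [map_pow, map_add, keep_X, keep_C, if_pos hmT]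
  -- e = s′ + f with f a monomial of U, hence supported in Tc
  have hsa : monomial s a = C a * monomial s (1 : k) := by rw [C_mul_monomial, mul_one]
  rw [hsa, map_mul, translate_C, hmono] at he
  have hc1 : coeff e (C a * (monomial s' (1 : k) * U)) ≠ 0 := MvPolynomial.mem_support_iff.mp he
  rw [coeff_C_mul] at hc1
  have hc2 : coeff e (monomial s' (1 : k) * U) ≠ 0 := right_ne_zero_of_mul hc1
  obtain ⟨hle, hcf⟩ := le_and_coeff_of_coeff_monomial_mul hc2
  have hf : (e - s').support ⊆ Tc := by
    have := mem_support_of_keep (T := Tc) (G := U) (e := e - s') (by rw [hkeepU]; exact MvPolynomial.mem_support_iff.mpr hcf)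
    exact this.2
  have he' : e = s' + (e - s') := (add_tsub_cancel_of_le hle).symm
  rw [he', sig_add, sig_eq_zero_of_support (f := e - s') (fun m hm => ?_), add_zero]
  · -- sig s′ = sig s on K (c = 0 there)
    ext m; rw [sig_apply, sig_apply]
    split_ifs with hm
    · rw [hs'app m, if_pos (hc m hm)]
    · rfl
  · by_contra hne
    have := Finset.mem_filter.mp (hf (Finsupp.mem_support_iff.mpr hne))
    exact this.2 (hc m hm)

/-- ★ THE FIBRE TRANSLATION ACTS PIECEWISE: `piece σ (translate c G) = translate c (piece σ G)` when `c` vanishes on the kept letters — no cancellation across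
signatures. [OURS · L1 W4.5a] -/
theorem piece_translate {K : Finset Letter} {c : Letter → k} (hc : ∀ m ∈ K, c m = 0) (σ : Expo) (G : YPoly k) :
    piece K σ (translate c G) = translate c (piece K σ G) := by
  classical
  induction G using MvPolynomial.induction_on' with
  | monomial s a =>
    rw [piece_of_forall_sig (fun e he => sig_translate_monomial hc s a he) σ,
      piece_of_forall_sig (σ₀ := sig K s) (P := monomial s a) (fun e he => ?_) σ]
    · split_ifs
      · rfl
      · rw [map_zero]
    · rw [support_monomial] at he
      split_ifs at he with ha
      · exact absurd he (Finset.notMem_empty e)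
      · rw [Finset.mem_singleton] at he; rw [he]
  | add p q hp hq => rw [map_add, piece_add, piece_add, map_add, hp, hq]

/-! ## 3. The one-step law at every fibre point -/

/-- Total-degree bookkeeping for a monomial of `N′` of prescribed signature. [plumbing] -/
theorem tdeg_le_of_sig {S S' : Stage k} {Nor : Finset Letter} {L : Letter} {α α' : Expo} {N N' : YPoly k}
    (hL : L ∈ Nor) (hch : IsChart S Nor L S') (hres : IsResidual S.Exc S.D α N) (hres' : IsResidual S'.Exc S'.D α' N')
    {ν : ℕ} (hν₁ : ∃ e ∈ N.support, norDeg Nor e = ν) (hν₂ : ∀ e ∈ N.support, ν ≤ norDeg Nor e)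
    {e₀ : Expo} (he₀ : e₀ ∈ N.support) {e' : Expo} (he' : e' ∈ N'.support)
    (hsig : sig (insert L (Finset.univ \ Nor)) e' = sig (insert L (Finset.univ \ Nor)) (tau Nor L e₀ - Finsupp.single L ν)) :
    tdeg e' + ν ≤ norDeg Nor e₀ + tdeg e₀ := by
  classical
  set K : Finset Letter := insert L (Finset.univ \ Nor) with hK
  obtain ⟨e, he, heq⟩ := (residual_transport hL hch hres hres' hν₁ hν₂ e').mp he'
  -- read the signature equation at L and at the letters off Nor
  have hsigL := congrArg (fun f => f L) hsig
  have hsL : ∀ f : Expo, sig K f L = f L := fun f => by rw [sig_apply, if_pos (Finset.mem_insert_self L _)]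
  simp only [hsL, Finsupp.tsub_apply, Finsupp.single_eq_same, tau_apply_self Nor L e₀ hL] at hsigL
  -- e′_L + ν = norDeg e (from the transport equation) and e′_L = norDeg e₀ − ν
  have h1 : e' L + ν = norDeg Nor e := by
    have := congrArg (fun f => f L) heq
    simp only [Finsupp.coe_add, Pi.add_apply, Finsupp.single_eq_same, tau_apply_self Nor L e hL] at this
    exact this
  have hν0 : ν ≤ norDeg Nor e₀ := hν₂ e₀ he₀
  have hne : norDeg Nor e = norDeg Nor e₀ := by omega
  -- off Nor: e′ agrees with e and with e₀
  have hoff : ∀ m, m ∉ Nor → e' m = e m ∧ e' m = e₀ m := by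
    intro m hm
    have hmL : m ≠ L := fun h => hm (h ▸ hL)
    have hmK : m ∈ K := by rw [hK]; exact Finset.mem_insert_of_mem (Finset.mem_sdiff.mpr ⟨Finset.mem_univ m, hm⟩)
    have a1 := congrArg (fun f => f m) heq
    simp only [Finsupp.coe_add, Pi.add_apply, Finsupp.single_apply, if_neg (Ne.symm hmL), add_zero, tau_apply_ne Nor L e hmL] at a1
    have a2 := congrArg (fun f => f m) hsig
    simp only [sig_apply, if_pos hmK, Finsupp.tsub_apply, Finsupp.single_apply, if_neg (Ne.symm hmL), tau_apply_ne Nor L e₀ hmL, Nat.sub_zero] at a2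
    exact ⟨a1, a2⟩
  -- in Nor ∖ {L}: e′ agrees with e
  have hT : ∀ m, m ∈ Nor → m ≠ L → e' m = e m := by
    intro m _ hmL
    have a1 := congrArg (fun f => f m) heq
    simp only [Finsupp.coe_add, Pi.add_apply, Finsupp.single_apply, if_neg (Ne.symm hmL), add_zero, tau_apply_ne Nor L e hmL] at a1
    exact a1
  -- total degrees: split tdeg over {L}, Nor ∖ {L}, off Nor
  have hsplit : ∀ f : Expo, tdeg f = f L + (norDeg Nor f - f L) + (tdeg f - norDeg Nor f) := by
    intro f
    have h1 : f L ≤ norDeg Nor f := by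
      unfold norDeg; exact Finset.single_le_sum (fun _ _ => Nat.zero_le _) hL
    have h2 : norDeg Nor f ≤ tdeg f := norDeg_le_tdeg Nor f
    omega
  have hA : norDeg Nor e' - e' L = norDeg Nor e - e L := by
    have : norDeg Nor e' + e L = norDeg Nor e + e' L := by
      unfold norDeg
      rw [← Finset.add_sum_erase Nor (fun m => e' m) hL, ← Finset.add_sum_erase Nor (fun m => e m) hL]
      rw [Finset.sum_congr rfl (fun m hm => hT m (Finset.mem_of_mem_erase hm) (Finset.ne_of_mem_erase hm))]
      ring
    omega
  have hB : tdeg e' - norDeg Nor e' = tdeg e₀ - norDeg Nor e₀ := by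
    -- both equal the sum of the exponents off Nor
    have key : ∀ f : Expo, tdeg f - norDeg Nor f = ∑ m ∈ Finset.univ \ Nor, f m := by
      intro f
      have : tdeg f = norDeg Nor f + ∑ m ∈ Finset.univ \ Nor, f m := by
        unfold tdeg norDeg; rw [← Finset.sum_sdiff (Finset.subset_univ Nor)]; ring
      omega
    rw [key, key]
    exact Finset.sum_congr rfl fun m hm => (hoff m (Finset.mem_sdiff.mp hm).2).2
  have hC : norDeg Nor e - e L ≤ norDeg Nor e := Nat.sub_le _ _
  rw [hsplit e', hsplit e₀, hA, hB]
  have h3 : e₀ L ≤ norDeg Nor e₀ := by unfold norDeg; exact Finset.single_le_sum (fun _ _ => Nat.zero_le _) hL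
  have h4 : norDeg Nor e₀ ≤ tdeg e₀ := norDeg_le_tdeg Nor e₀
  have h5 : e L ≤ norDeg Nor e := by unfold norDeg; exact Finset.single_le_sum (fun _ _ => Nat.zero_le _) hL
  omega

/-- ★★ THE ONE-STEP LAW AT EVERY FIBRE POINT: one blow-up of `Z = V(x, y_Nor)` at a base point with residual order `≤ ρ` and minimal normal degree `ν`, followed by the
passage to ANY point of the fibre over the base point, gives `ρ″ ≤ ndeg_Z e₀ + tdeg e₀ − ν ≤ 2ρ − ν` for every residual decomposition there (`e₀` any monomial of `N`
with `tdeg e₀ ≤ ρ`). [OURS · L1 W4.5a] -/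
theorem ordLE_fibre_law {S S' S'' : Stage k} {Nor : Finset Letter} {L : Letter} {α α' α'' : Expo} {N N' N'' : YPoly k} {c : Letter → k}
    (hL : L ∈ Nor) (hch : IsChart S Nor L S') (hres : IsResidual S.Exc S.D α N) (hres' : IsResidual S'.Exc S'.D α' N')
    {ν : ℕ} (hν₁ : ∃ e ∈ N.support, norDeg Nor e = ν) (hν₂ : ∀ e ∈ N.support, ν ≤ norDeg Nor e)
    (htr : IsTranslate S' c S'') (hc : ∀ m, m ∉ Nor.erase L → c m = 0) (hres'' : IsResidual S''.Exc S''.D α'' N'')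
    {ρ : ℕ} (hρ : OrdLE N ρ) : OrdLE N'' (2 * ρ - ν) := by
  classical
  set K : Finset Letter := insert L (Finset.univ \ Nor) with hK
  have hcK : ∀ m ∈ K, c m = 0 := by
    intro m hm
    rw [hK, Finset.mem_insert, Finset.mem_sdiff] at hm
    apply hc
    rw [Finset.mem_erase, not_and_or, not_not]
    rcases hm with h | h
    · exact Or.inl h
    · exact Or.inr h.2
  obtain ⟨e₀, he₀, hρ₀⟩ := hρ
  -- the transform of e₀ is a monomial of N′
  have hν0 : ν ≤ norDeg Nor e₀ := hν₂ e₀ he₀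
  have hle : Finsupp.single L ν ≤ tau Nor L e₀ := by
    intro m
    by_cases hm : m = L
    · subst hm; rw [Finsupp.single_eq_same, tau_apply_self Nor _ e₀ hL]; exact hν0
    · rw [Finsupp.single_apply, if_neg (Ne.symm hm)]; exact Nat.zero_le _
  have hmem : tau Nor L e₀ - Finsupp.single L ν ∈ N'.support :=
    (residual_transport hL hch hres hres' hν₁ hν₂ _).mpr ⟨e₀, he₀, tsub_add_cancel_of_le hle⟩
  set σ₀ := sig K (tau Nor L e₀ - Finsupp.single L ν) with hσ₀
  -- the piece P of N′ of signature σ₀: non-zero, total degree ≤ B := ndeg e₀ + tdeg e₀ − ν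
  have hP0 : piece K σ₀ N' ≠ 0 := piece_ne_zero hmem
  have hdeg : (piece K σ₀ N').totalDegree ≤ norDeg Nor e₀ + tdeg e₀ - ν := by
    refine totalDegree_le_of_forall fun e' he' => ?_
    obtain ⟨he'N, hsig⟩ := mem_support_of_piece he'
    have := tdeg_le_of_sig hL hch hres hres' hν₁ hν₂ he₀ he'N hsig
    omega
  -- the residual at S″ is U · translate c N′
  obtain ⟨hD'', hExc'', -⟩ := htr
  obtain ⟨α₁, U, hres₁, -, -, hU0, -⟩ := isResidual_translate c hres' hExc''
  rw [← hD''] at hres₁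
  obtain ⟨-, hNeq⟩ := residual_unique hres₁ hres''
  rw [← hNeq]
  -- translate c P ≠ 0 has a monomial of degree ≤ B, which is a monomial of translate c N′ (pieces do not mix)
  have h1 : OrdLE (translate c (piece K σ₀ N')) (norDeg Nor e₀ + tdeg e₀ - ν) := ordLE_translate_of_totalDegree_le hP0 hdeg c
  rw [← piece_translate hcK] at h1
  obtain ⟨f, hf, hfd⟩ := h1
  have hf' : f ∈ (translate c N').support := (mem_support_of_piece hf).1
  have h2 : OrdLE (translate c N') (2 * ρ - ν) := by
    refine ⟨f, hf', ?_⟩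
    have := norDeg_le_tdeg Nor e₀
    omega
  exact ordLE_unit_mul hU0 h2

/-- COROLLARY (the law in `ρ`-form, as in K10e/K10f at chart origins): with `ρ` the residual order at the base point — attained by a monomial — the residual order at
every point of the fibre is at most `2ρ − ν`; for the POINT centre (`ν = ρ`) it does not increase anywhere on the fibre. [OURS · L1 W4.5a] -/
theorem ordLE_fibre_point_law {S S' S'' : Stage k} {L : Letter} {α α' α'' : Expo} {N N' N'' : YPoly k} {c : Letter → k}
    (hch : IsChart S Finset.univ L S') (hres : IsResidual S.Exc S.D α N) (hres' : IsResidual S'.Exc S'.D α' N')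
    (htr : IsTranslate S' c S'') (hc : ∀ m, m ∉ Finset.univ.erase L → c m = 0) (hres'' : IsResidual S''.Exc S''.D α'' N'')
    {ρ : ℕ} (hρ₁ : ∃ e ∈ N.support, tdeg e = ρ) (hρ₂ : ∀ e ∈ N.support, ρ ≤ tdeg e) : OrdLE N'' ρ := by
  have hnd : ∀ e : Expo, norDeg Finset.univ e = tdeg e := fun e => rfl
  obtain ⟨e₀, he₀, hρ₀⟩ := hρ₁
  have h := ordLE_fibre_law (Finset.mem_univ L) hch hres hres' (ν := ρ) ⟨e₀, he₀, by rw [hnd]; exact hρ₀⟩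
    (fun e he => by rw [hnd]; exact hρ₂ e he) htr hc hres'' ⟨e₀, he₀, hρ₀.le⟩
  have : 2 * ρ - ρ = ρ := by omega
  rw [this] at h; exact h

end Summit.ResolutionOfSingularities.ResolutionOfSingularities.Theorems.FInjectiveMacaulayfication.LastCentreFibreLaw

end
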